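import Mathlib
import Summits.NavierStokesRegularity.NavierStokesRegularity.Theorems.BarrierStepRungThreeCertificateProfileBelow
import Summits.NavierStokesRegularity.NavierStokesRegularity.Theorems.BarrierStepRungThreeCertificateProfileSlack
import HarnessLib

/-!
# Profile kit for window certificates in the repaired format K2″ (route `BarrierStepRungThree`),
  part III: the assembled kit

Main theorem `CertificateProfile.certificateProfileKit` (items stmt-NavierStokesRegularity-23420 /
23648 / 23942; parts I–II in `…CertificateProfileAbove/Below/Slack.lean`).  From finitely many design
numbers — `θ ≤ 1/2`, clock `c`, window `[kLo, kLo+n)`, coefficient sums `A₀, Aₓ, A₁` of the table,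
window energy caps `Φ` with bounds `E_w, E₀, q_top`, lower-profile numbers `Q_b, G, λ` — and finitely
many NUMERIC side conditions (`hz`: `2cA₁ 2^{5K/2} q_top ≤ 1/2`; `G² < 8`; `2^θ ≤ λG`;
`2^{2θ} 2E₀ ≤ (λ Q_b G)²`; the two tail conditions `hT1`, `hT2`), it produces an outside profile
`(r, q, ρ)`, an envelope `env` and a slack majorant `Ψ` satisfying clauses 14, 15, 16, 17, 18, the
envelope part of 19, and 20 of the repaired certificate format (hypotheses of
`Theorems.BarrierSoundness.barrierSoundness₃`) VERBATIM, plus: `Ψ (kLo+j) ≤ c 2^{-kLo} W` on the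
window (to choose the defect margin `η` of clause 19), the boundary caps `q (kLo-1) = Q_b G` and
`q (kLo+n) = 2cA₁ 2^{5(K-1)/2} q_top²` entering the window field, positivity of `q`, the TAIL RATE
clause 26 and the outside conjunct of the GOAL clause 27 on every REGION state.  A certificate writer
is then left with the POLYNOMIAL clauses about the window only (datum, properness, clock floor,
decrease with margin, gradient bound — see `Theorems.PolynomialClock.*` — and goal ⇒ window re-entry).

DESIGN READING (numbers, not adjectives): the only smallness the tail bookkeeping imposes above the
window is `z₀ = 2cA₁ 2^{5K/2} q_top ≤ 1/2` on the TOP window shell cap (e.g. `c = 2.5`, `A₁ = 1`,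
`K = 3`: `q_top ≤ 5.5e-4`); below the window the growth factor must satisfy `2^θ ≤ λG`, `G² < 8`, and
the tail conditions are weakest for deep windows (`2^{5(kLo-1)/2}` in `hT1`).

HONEST FRAMING: bookkeeping for certificates about Tao-type MODEL lattice pseudo-flows (rung TL-M3);
it constructs no certificate, proves nothing about any table, and says nothing about the Navier–Stokes
equations; no summit is proved by this file.
-/

noncomputable section

-- the sub-problem namespace repeats the summit name by design (D-0017)
set_option linter.dupNamespace false

namespace Summit.NavierStokesRegularity.NavierStokesRegularity.Theorems

namespace CertificateProfile

open scoped BigOperators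
open Literature.Analysis.FluidPDE Literature.Analysis.FluidPDE.TaoCascade

/-! ### The profile kit -/

/-- Monotonicity of the slack majorant on the window: `c 2^{-(kLo+j)} W ≤ c 2^{-kLo} W`. [folklore] -/
theorem slack_majorant_window_le {c W : ℝ} (hc : 0 ≤ c) (hW : 0 ≤ W) (kLo : ℤ) (j : ℕ) :
    c * (2 : ℝ) ^ (-((kLo + (j : ℕ) : ℤ) : ℝ)) * W ≤ c * (2 : ℝ) ^ (-(kLo : ℝ)) * W := by
  have hj : (0 : ℝ) ≤ (j : ℝ) := Nat.cast_nonneg j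
  have h2 : (2 : ℝ) ^ (-((kLo + (j : ℕ) : ℤ) : ℝ)) ≤ (2 : ℝ) ^ (-(kLo : ℝ)) := by
    refine Real.rpow_le_rpow_of_exponent_le (by norm_num) ?_
    push_cast
    linarith
  exact mul_le_mul_of_nonneg_right (mul_le_mul_of_nonneg_left h2 hc) hW

section Assembly

variable {θ c : ℝ} {n : ℕ} {kLo K : ℤ} {α : Fin 4 → Fin 4 → Fin 4 → ℤ × ℤ × ℤ → ℝ}
  {Φ : Fin 4 → Fin n → ℝ} {A₀ Aₓ A₁ E_w E₀ q_top Q_b G lam κ z₀ W : ℝ} {q r ρ env Ψ : ℤ → ℝ}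

/-- **The profile kit, for given profile functions.** If `q, r, ρ, env, Ψ` agree on the three zones
(below / window / above) with the closed-form profile of this file (hypotheses `hqb … hΨ`) and the
finitely many numeric side conditions hold, then the sequence clauses 14–18, 20 of the repaired
certificate format hold verbatim, together with the envelope part of clause 19, the window bound on
`Ψ`, the boundary caps, positivity of `q`, the TAIL RATE clause 26 and the outside conjunct of the
GOAL clause 27. [cite: Tao2016AveragedNS, §6.2 Prop. 6.3 (vi)–(ix) and §6.4 Lemma 6.7; §4 (4.5),
(4.8)–(4.10)] -/
theorem kit_of_profile
    (hθ : θ ≤ 1 / 2) (hc : 0 < c) (hkLo : kLo ≤ 0) (hkn : (2 : ℤ) ≤ kLo + n) (hK : K = kLo + n)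
    (hA₀ : ∀ i, (∑ i₁ : Fin 4, ∑ i₂ : Fin 4, |α i₁ i₂ i (0, 0, 0)|) ≤ A₀)
    (hAₓ : ∀ i, (∑ i₁ : Fin 4, ∑ i₂ : Fin 4, |α i₁ i₂ i (1, 0, 0)|) +
      (∑ i₁ : Fin 4, ∑ i₂ : Fin 4, |α i₁ i₂ i (0, 1, 0)|) ≤ Aₓ)
    (hA₁i : ∀ i, (∑ i₁ : Fin 4, ∑ i₂ : Fin 4, |α i₁ i₂ i (0, 0, 1)|) ≤ A₁) (hA₁ : 0 < A₁)
    (hA₁s : (∑ i₁ : Fin 4, ∑ i₂ : Fin 4, ∑ i₃ : Fin 4, |α i₁ i₂ i₃ (0, 0, 1)|) ≤ A₁)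
    (hΦw : ∀ i j, Φ i j ≤ E_w) (hEw : 0 ≤ E_w) (hE₀ : 0 ≤ E₀)
    (hΦ₀ : ∀ (i : Fin 4) (j : Fin n), (j : ℕ) = 0 → Φ i j ≤ E₀) (hqt : 0 < q_top)
    (hΦtop : ∀ (i : Fin 4) (j : Fin n), (j : ℕ) + 1 = n → 2 * Φ i j ≤ q_top ^ 2)
    (hκ : κ = 2 * c * A₁) (hz₀ : z₀ = κ * (2 : ℝ) ^ ((5 : ℝ) * (K : ℝ) / 2) * q_top)
    (hz2 : z₀ ≤ 1 / 2)
    (hQb : 0 < Q_b) (hG : 0 < G) (hG8 : G ^ 2 < 8) (hlam : lam < 1) (hlamG : (2 : ℝ) ^ θ ≤ lam * G)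
    (hgoal0 : (2 : ℝ) ^ (2 * θ) * (2 * E₀) ≤ (lam * Q_b * G) ^ 2)
    (hT1 : c * ((2 : ℝ) ^ ((5 : ℝ) * ((kLo - 1 : ℤ) : ℝ) / 2) *
        (A₀ * (Q_b * G) ^ 2 + Aₓ * (Q_b * G) * Real.sqrt (2 * E₀)) +
        (2 : ℝ) ^ ((5 : ℝ) * ((kLo - 2 : ℤ) : ℝ) / 2) * (A₁ * (Q_b * G ^ 2) ^ 2)) ≤
        (1 - lam) * (Q_b * G))
    (hT2 : c * Q_b * (2 : ℝ) ^ ((5 : ℝ) * (kLo : ℝ) / 2) * (G * (2 : ℝ) ^ (-(5 : ℝ) / 2)) ^ 2 *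
        (A₀ + Aₓ / G + A₁ * G ^ 2 * (2 : ℝ) ^ (-(5 : ℝ) / 2)) ≤ 1 - lam)
    (hWdef : W = Q_b ^ 2 / 2 * (2 : ℝ) ^ ((3 : ℝ) * (kLo : ℝ)) * (8 / (8 - G ^ 2)) +
        n * (2 : ℝ) ^ ((3 : ℝ) * ((K : ℝ) - 1)) * (E_w + q_top ^ 2 / 2) +
        4 / 3 * (2 : ℝ) ^ (-(2 : ℝ) * (K : ℝ)) / κ ^ 2)
    (hqb : ∀ k, k < kLo → q k = Q_b * G ^ (kLo - k).toNat)
    (hqw : ∀ k, kLo ≤ k → k < K - 1 → q k = q_top)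
    (hqa : ∀ k, K - 1 ≤ k →
      q k = z₀ ^ (2 ^ (k - K + 1).toNat) / (κ * (2 : ℝ) ^ ((5 : ℝ) * ((k : ℝ) + 1) / 2)))
    (hrb : ∀ k, k < kLo → r k = lam * q k) (hrw : ∀ k, kLo ≤ k → k < K → r k = 0)
    (hra : ∀ k, K ≤ k → r k = q k / 2)
    (hρb : ∀ k, k < kLo → ρ k = (1 - lam) * q k / c) (hρw : ∀ k, kLo ≤ k → k < K → ρ k = 0)
    (hρa : ∀ k, K ≤ k → ρ k = q k / (2 * c))
    (henvB : ∀ k, k < kLo → env k = q k ^ 2 / 2)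
    (henvW : ∀ k, kLo ≤ k → k ≤ K - 1 → env k = E_w + q_top ^ 2 / 2)
    (henvA : ∀ k, K ≤ k → env k = q k ^ 2 / 2)
    (hΨ : ∀ k, Ψ k = c * (2 : ℝ) ^ (-(k : ℝ)) * W) :
    (∀ (L' : ℕ) (k : ℤ), slackWeight 1 θ c env L' k ≤ Ψ k) ∧
      (∀ k : ℤ, 0 ≤ r k ∧ r k < q k ∧ 0 ≤ ρ k ∧ r k + c * ρ k ≤ q k ∧ q k ^ 2 / 2 ≤ env k) ∧
      (∀ k : ℤ, K ≤ k → (1 + 1 : ℝ) ^ ((5 : ℝ) * ((k - 1 : ℤ) : ℝ) / 2) *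
        (∑ i₁ : Fin 4, ∑ i₂ : Fin 4, ∑ i₃ : Fin 4, |α i₁ i₂ i₃ (0, 0, 1)|) * q (k - 1) ^ 2 ≤ ρ k) ∧
      (∀ (i : Fin 4) (j : Fin n), (j : ℕ) + 1 = n → 2 * Φ i j ≤ q (kLo + (j : ℕ)) ^ 2) ∧
      (∀ k : ℤ, K ≤ k → q (k + 1) ≤ (1 + 1 : ℝ) ^ (-θ) * r k) ∧
      (∀ (i : Fin 4) (j : Fin n), Φ i j ≤ env (kLo + (j : ℕ))) ∧
      (∀ j : Fin n, Ψ (kLo + (j : ℕ)) ≤ c * (2 : ℝ) ^ (-(kLo : ℝ)) * W) ∧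
      (∃ M₁ : ℝ, ∀ k : ℤ, K ≤ k → (1 + (1 + 1 : ℝ) ^ ((10 : ℝ) * (k : ℝ))) * q k ≤ M₁) ∧
      q (kLo - 1) = Q_b * G ∧
      q K = κ * (2 : ℝ) ^ ((5 : ℝ) * ((K - 1 : ℤ) : ℝ) / 2) * q_top ^ 2 ∧
      (∀ k : ℤ, 0 < q k) ∧
      (∀ (S F : Fin 4 → ℤ → ℝ), (∀ i k, S i k ^ 2 ≤ 2 * F i k) →
        (∀ i k, (k < kLo ∨ K ≤ k) → F i k ≤ q k ^ 2 / 2) →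
        (∀ (i : Fin 4) (j : Fin n), F i (kLo + (j : ℕ)) ≤ Φ i j) →
        ∀ (i : Fin 4) (k : ℤ), k < kLo →
          quadTerm 1 α (fun i' k' (_ : ℝ) => S i' k') i k 0 * S i k ≤ ρ k * |S i k|) ∧
      (∀ (F : Fin 4 → ℤ → ℝ), (∀ i k, (k < kLo ∨ K ≤ k) → F i k ≤ q k ^ 2 / 2) →
        (∀ (i : Fin 4) (j : Fin n), F i (kLo + (j : ℕ)) ≤ Φ i j) →
        ∀ a : ℝ, (1 + 1 : ℝ) ^ (-θ) ≤ a →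
          ∀ (i : Fin 4) (k : ℤ), k < kLo → F i (1 + k) / a ^ 2 ≤ r k ^ 2 / 2) := by
  have hκ0 : 0 < κ := by rw [hκ]; positivity
  have hz0 : 0 < z₀ := by
    rw [hz₀]; exact mul_pos (mul_pos hκ0 (Real.rpow_pos_of_pos (by norm_num) _)) hqt
  have hz1 : z₀ ≤ 1 := hz2.trans (by norm_num)
  have hn : 0 < n := by omega
  have hlam0 : 0 < lam := by
    have h2 : (0 : ℝ) < (2 : ℝ) ^ θ := Real.rpow_pos_of_pos (by norm_num) _
    nlinarith
  have hqtop : q (K - 1) = q_top := by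
    rw [above_at_top hqa, hz₀]
    have : (0 : ℝ) < (2 : ℝ) ^ ((5 : ℝ) * (K : ℝ) / 2) := Real.rpow_pos_of_pos (by norm_num) _
    field_simp
  have hqpos : ∀ k, 0 < q k := by
    intro k
    rcases lt_or_ge k kLo with h1 | h1
    · exact below_pos hQb hG hqb h1
    rcases lt_or_ge k (K - 1) with h2 | h2
    · rw [hqw k h1 h2]; exact hqt
    · exact above_pos hκ0 hz0 hqa h2
  have hW0 : 0 ≤ W := by
    have h8 : 0 < 8 - G ^ 2 := sub_pos.2 hG8
    have hA : 0 ≤ Q_b ^ 2 / 2 * (2 : ℝ) ^ ((3 : ℝ) * (kLo : ℝ)) * (8 / (8 - G ^ 2)) :=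
      mul_nonneg (mul_nonneg (div_nonneg (sq_nonneg _) zero_le_two)
        (Real.rpow_pos_of_pos zero_lt_two _).le) (div_pos (by norm_num) h8).le
    have hB : 0 ≤ (n : ℝ) * (2 : ℝ) ^ ((3 : ℝ) * ((K : ℝ) - 1)) * (E_w + q_top ^ 2 / 2) :=
      mul_nonneg (mul_nonneg (Nat.cast_nonneg n) (Real.rpow_pos_of_pos zero_lt_two _).le)
        (add_nonneg hEw (div_nonneg (sq_nonneg _) zero_le_two))
    have hC : 0 ≤ 4 / 3 * (2 : ℝ) ^ (-(2 : ℝ) * (K : ℝ)) / κ ^ 2 :=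
      div_nonneg (mul_nonneg (by norm_num) (Real.rpow_pos_of_pos zero_lt_two _).le) (sq_nonneg _)
    rw [hWdef]
    exact add_nonneg (add_nonneg hA hB) hC
  -- window bottom energies
  have hbottom : ∀ F : Fin 4 → ℤ → ℝ, (∀ (i : Fin 4) (j : Fin n), F i (kLo + (j : ℕ)) ≤ Φ i j) →
      ∀ i, F i kLo ≤ E₀ := by
    intro F hF i
    have h := hF i ⟨0, hn⟩
    simp only [Nat.cast_zero, add_zero] at h
    exact h.trans (hΦ₀ i ⟨0, hn⟩ rfl)
  -- `G 2^{-5/2} ≤ 1`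
  have hu : G * (2 : ℝ) ^ (-(5 : ℝ) / 2) ≤ 1 := by
    have hw0 : 0 < (2 : ℝ) ^ (-(5 : ℝ) / 2) := Real.rpow_pos_of_pos (by norm_num) _
    have hw2 : ((2 : ℝ) ^ (-(5 : ℝ) / 2)) ^ 2 = 1 / 32 := by
      rw [two_rpow_pow, show ((2 : ℕ) : ℝ) * (-(5 : ℝ) / 2) = -(5 : ℝ) by norm_num,
        Real.rpow_neg (by norm_num), show (5 : ℝ) = ((5 : ℕ) : ℝ) by norm_num, Real.rpow_natCast]
      norm_num
    have hsq : (G * (2 : ℝ) ^ (-(5 : ℝ) / 2)) ^ 2 ≤ 1 := by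
      rw [mul_pow, hw2]; nlinarith
    nlinarith [mul_pos hG hw0]
  refine ⟨?_, ?_, ?_, ?_, ?_, ?_, ?_, above_clause20 hκ0 hz0 hz2 hqa, below_at hqb, ?_, hqpos, ?_, ?_⟩
  · -- clause 14: the slack majorant
    intro L' k
    rw [hΨ, hWdef]
    exact slackWeight_le hθ hc hQb hG hG8 hκ0 hz0 hz1 hEw hK hqb hqa henvB henvW henvA L' k
  · -- clause 15
    intro k
    have hqk := hqpos k
    rcases lt_or_ge k kLo with h1 | h1
    · rw [hrb k h1, hρb k h1, henvB k h1]
      have h1l : 0 ≤ 1 - lam := by linarith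
      refine ⟨(mul_pos hlam0 hqk).le, (mul_lt_iff_lt_one_left hqk).2 hlam,
        div_nonneg (mul_nonneg h1l hqk.le) hc.le, le_of_eq ?_, le_rfl⟩
      field_simp
      ring
    rcases lt_or_ge k K with h2 | h2
    · rw [hrw k h1 h2, hρw k h1 h2, henvW k h1 (by omega)]
      have hqq : q k = q_top := by
        rcases lt_or_eq_of_le (show k ≤ K - 1 by omega) with h3 | h3
        · exact hqw k h1 h3
        · rw [h3]; exact hqtop
      refine ⟨le_rfl, hqk, le_rfl, by simpa using hqk.le, by rw [hqq]; linarith⟩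
    · rw [hra k h2, hρa k h2, henvA k h2]
      refine ⟨by linarith, by linarith, div_nonneg hqk.le (by linarith), le_of_eq ?_, le_rfl⟩
      field_simp
      ring
  · -- clause 16: the one-directional recursion above the window
    intro k hk
    rw [show (1 + 1 : ℝ) = 2 by norm_num, hρa k hk]
    exact above_clause16 hc hA₁s hκ hκ0 hqa hk
  · -- clause 17: base link at the top window shell
    intro i j hj
    have : kLo + (j : ℕ) = K - 1 := by omega
    rw [this, hqtop]
    exact hΦtop i j hj
  · -- clause 18: re-entry decay above the window
    intro k hk
    rw [hra k hk]
    exact above_clause18 hθ hκ0 hz0 hz2 hqa hk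
  · -- clause 19, envelope part
    intro i j
    rw [henvW _ (by omega) (by omega)]
    exact (hΦw i j).trans (le_add_of_nonneg_right (by positivity))
  · -- Ψ on the window
    intro j
    rw [hΨ]
    exact slack_majorant_window_le hc.le hW0 kLo j
  · -- the cap of the shell above the window
    rw [above_recursion hκ0 hqa le_rfl, hqtop]
  · -- clause 26: tail rate below the window
    intro S F hSF hFout hFwin
    exact tail_rate_below α hA₀ hAₓ hA₁i hc hQb hG hu hqb hρb hT1 hT2 S F hSF
      (fun i k hk => hFout i k (Or.inl hk)) (hbottom F hFwin)
  · -- clause 27: the goal's outside conjunct below the window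
    intro F hFout hFwin a ha
    exact goal_outside_below hQb hG hE₀ hqb hrb hlamG hgoal0 F
      (fun i k hk => hFout i k (Or.inl hk)) (hbottom F hFwin) ha

end Assembly

/-- **PROFILE KIT for window certificates in the repaired format K2″.** Given the design numbers of
a window certificate — ratio exponent `θ ≤ 1/2`, clock `c > 0`, window `[kLo, kLo+n)` (`kLo ≤ 0`,
`kLo + n ≥ 2`), the table `α` through the coefficient sums `A₀` (shift `(0,0,0)`), `Aₓ` (shifts
`(1,0,0), (0,1,0)`), `A₁` (the pump shift `(0,0,1)`), the window energy caps `Φ` with bounds `E_w` (all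
shells), `E₀` (bottom shell) and `q_top` (`2Φ_top ≤ q_top²`), and the lower-profile numbers `Q_b, G, λ` —
satisfying the FINITELY MANY numeric side conditions `hz` (doubly-exponential smallness above:
`2cA₁ 2^{5K/2} q_top ≤ 1/2`, `K = kLo+n`), `hG8` (`G² < 8`), `hlamG` (`2^θ ≤ λG`), `hgoal0`
(`2^{2θ}·2E₀ ≤ (λ Q_b G)²`), `hT1`, `hT2` (tail rate at `kLo-1` and at all `k ≤ kLo-2`), there EXIST an
outside profile `(r, q, ρ)`, an envelope `env` and a slack majorant `Ψ` satisfying clauses 14, 15, 16,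
17, 18, the envelope part of 19, and 20 of the certificate format (hypotheses of
`Theorems.BarrierSoundness.barrierSoundness₃`) VERBATIM, together with: the bound
`Ψ (kLo+j) ≤ c 2^{-kLo} W` on the window (for choosing the defect margin `η` in clause 19), the two
boundary caps `q (kLo-1) = Q_b G`, `q (kLo+n) = 2cA₁ 2^{5(K-1)/2} q_top²` that enter the window field,
positivity of `q`, the TAIL RATE clause below the window (26) and the outside conjunct of the GOAL clause
(27) on every REGION state.  What remains for a certificate writer are the polynomial clauses about the
window (datum, properness, clock floor, decrease with margin, gradient bound, goal ⇒ window re-entry).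
[cite: Tao2016AveragedNS, §6.2 Prop. 6.3 (vi)–(ix) and §6.4 Lemma 6.7 (envelopes, re-entry ratio,
cumulative slack); §4 (4.5), (4.8)–(4.10)] -/
theorem certificateProfileKit
    (θ c : ℝ) (n : ℕ) (kLo : ℤ) (α : Fin 4 → Fin 4 → Fin 4 → ℤ × ℤ × ℤ → ℝ)
    (Φ : Fin 4 → Fin n → ℝ) (A₀ Aₓ A₁ E_w E₀ q_top Q_b G lam : ℝ)
    (hθ : θ ≤ 1 / 2) (hc : 0 < c) (hkLo : kLo ≤ 0) (hkn : (2 : ℤ) ≤ kLo + n)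
    (hA₀ : ∀ i, (∑ i₁ : Fin 4, ∑ i₂ : Fin 4, |α i₁ i₂ i (0, 0, 0)|) ≤ A₀)
    (hAₓ : ∀ i, (∑ i₁ : Fin 4, ∑ i₂ : Fin 4, |α i₁ i₂ i (1, 0, 0)|) +
      (∑ i₁ : Fin 4, ∑ i₂ : Fin 4, |α i₁ i₂ i (0, 1, 0)|) ≤ Aₓ)
    (hA₁i : ∀ i, (∑ i₁ : Fin 4, ∑ i₂ : Fin 4, |α i₁ i₂ i (0, 0, 1)|) ≤ A₁) (hA₁ : 0 < A₁)
    (hA₁s : (∑ i₁ : Fin 4, ∑ i₂ : Fin 4, ∑ i₃ : Fin 4, |α i₁ i₂ i₃ (0, 0, 1)|) ≤ A₁)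
    (hΦ0 : ∀ i j, 0 ≤ Φ i j) (hΦw : ∀ i j, Φ i j ≤ E_w) (hE₀ : 0 ≤ E₀)
    (hΦ₀ : ∀ (i : Fin 4) (j : Fin n), (j : ℕ) = 0 → Φ i j ≤ E₀) (hqt : 0 < q_top)
    (hΦtop : ∀ (i : Fin 4) (j : Fin n), (j : ℕ) + 1 = n → 2 * Φ i j ≤ q_top ^ 2)
    (hz : 2 * c * A₁ * (2 : ℝ) ^ ((5 : ℝ) * ((kLo + n : ℤ) : ℝ) / 2) * q_top ≤ 1 / 2)
    (hQb : 0 < Q_b) (hG : 0 < G) (hG8 : G ^ 2 < 8) (hlam : lam < 1) (hlamG : (2 : ℝ) ^ θ ≤ lam * G)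
    (hgoal0 : (2 : ℝ) ^ (2 * θ) * (2 * E₀) ≤ (lam * Q_b * G) ^ 2)
    (hT1 : c * ((2 : ℝ) ^ ((5 : ℝ) * ((kLo - 1 : ℤ) : ℝ) / 2) *
        (A₀ * (Q_b * G) ^ 2 + Aₓ * (Q_b * G) * Real.sqrt (2 * E₀)) +
        (2 : ℝ) ^ ((5 : ℝ) * ((kLo - 2 : ℤ) : ℝ) / 2) * (A₁ * (Q_b * G ^ 2) ^ 2)) ≤
        (1 - lam) * (Q_b * G))
    (hT2 : c * Q_b * (2 : ℝ) ^ ((5 : ℝ) * (kLo : ℝ) / 2) * (G * (2 : ℝ) ^ (-(5 : ℝ) / 2)) ^ 2 *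
        (A₀ + Aₓ / G + A₁ * G ^ 2 * (2 : ℝ) ^ (-(5 : ℝ) / 2)) ≤ 1 - lam) :
    ∃ (r q ρ env Ψ : ℤ → ℝ),
      (∀ (L' : ℕ) (k : ℤ), slackWeight 1 θ c env L' k ≤ Ψ k) ∧
      (∀ k : ℤ, 0 ≤ r k ∧ r k < q k ∧ 0 ≤ ρ k ∧ r k + c * ρ k ≤ q k ∧ q k ^ 2 / 2 ≤ env k) ∧
      (∀ k : ℤ, kLo + n ≤ k → (1 + 1 : ℝ) ^ ((5 : ℝ) * ((k - 1 : ℤ) : ℝ) / 2) *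
        (∑ i₁ : Fin 4, ∑ i₂ : Fin 4, ∑ i₃ : Fin 4, |α i₁ i₂ i₃ (0, 0, 1)|) * q (k - 1) ^ 2 ≤ ρ k) ∧
      (∀ (i : Fin 4) (j : Fin n), (j : ℕ) + 1 = n → 2 * Φ i j ≤ q (kLo + (j : ℕ)) ^ 2) ∧
      (∀ k : ℤ, kLo + n ≤ k → q (k + 1) ≤ (1 + 1 : ℝ) ^ (-θ) * r k) ∧
      (∀ (i : Fin 4) (j : Fin n), Φ i j ≤ env (kLo + (j : ℕ))) ∧
      (∀ j : Fin n, Ψ (kLo + (j : ℕ)) ≤ c * (2 : ℝ) ^ (-(kLo : ℝ)) *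
        (Q_b ^ 2 / 2 * (2 : ℝ) ^ ((3 : ℝ) * (kLo : ℝ)) * (8 / (8 - G ^ 2)) +
          n * (2 : ℝ) ^ ((3 : ℝ) * (((kLo + n : ℤ) : ℝ) - 1)) * (E_w + q_top ^ 2 / 2) +
          4 / 3 * (2 : ℝ) ^ (-(2 : ℝ) * ((kLo + n : ℤ) : ℝ)) / (2 * c * A₁) ^ 2)) ∧
      (∃ M₁ : ℝ, ∀ k : ℤ, kLo + n ≤ k → (1 + (1 + 1 : ℝ) ^ ((10 : ℝ) * (k : ℝ))) * q k ≤ M₁) ∧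
      q (kLo - 1) = Q_b * G ∧
      q (kLo + n) = 2 * c * A₁ * (2 : ℝ) ^ ((5 : ℝ) * ((kLo + n - 1 : ℤ) : ℝ) / 2) * q_top ^ 2 ∧
      (∀ k : ℤ, 0 < q k) ∧
      (∀ (S F : Fin 4 → ℤ → ℝ), (∀ i k, S i k ^ 2 ≤ 2 * F i k) →
        (∀ i k, (k < kLo ∨ kLo + n ≤ k) → F i k ≤ q k ^ 2 / 2) →
        (∀ (i : Fin 4) (j : Fin n), F i (kLo + (j : ℕ)) ≤ Φ i j) →
        ∀ (i : Fin 4) (k : ℤ), k < kLo →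
          quadTerm 1 α (fun i' k' (_ : ℝ) => S i' k') i k 0 * S i k ≤ ρ k * |S i k|) ∧
      (∀ (F : Fin 4 → ℤ → ℝ), (∀ i k, (k < kLo ∨ kLo + n ≤ k) → F i k ≤ q k ^ 2 / 2) →
        (∀ (i : Fin 4) (j : Fin n), F i (kLo + (j : ℕ)) ≤ Φ i j) →
        ∀ a : ℝ, (1 + 1 : ℝ) ^ (-θ) ≤ a →
          ∀ (i : Fin 4) (k : ℤ), k < kLo → F i (1 + k) / a ^ 2 ≤ r k ^ 2 / 2) := by
  have hn : 0 < n := by omega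
  have hEw : 0 ≤ E_w := (hΦ0 0 ⟨0, hn⟩).trans (hΦw 0 ⟨0, hn⟩)
  -- the profile (below: geometric; window: `q_top`; above: doubly exponential), r, ρ, env, Ψ
  refine ⟨fun k => if k < kLo then lam * (Q_b * G ^ (kLo - k).toNat) else if k < kLo + n then 0 else
      ((2 * c * A₁ * (2 : ℝ) ^ ((5 : ℝ) * ((kLo + n : ℤ) : ℝ) / 2) * q_top) ^ (2 ^ (k - (kLo + n) + 1).toNat) /
        (2 * c * A₁ * (2 : ℝ) ^ ((5 : ℝ) * ((k : ℝ) + 1) / 2))) / 2,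
    fun k => if k < kLo then Q_b * G ^ (kLo - k).toNat else if k < kLo + n - 1 then q_top else
      (2 * c * A₁ * (2 : ℝ) ^ ((5 : ℝ) * ((kLo + n : ℤ) : ℝ) / 2) * q_top) ^ (2 ^ (k - (kLo + n) + 1).toNat) /
        (2 * c * A₁ * (2 : ℝ) ^ ((5 : ℝ) * ((k : ℝ) + 1) / 2)),
    fun k => if k < kLo then (1 - lam) * (Q_b * G ^ (kLo - k).toNat) / c else if k < kLo + n then 0 else
      ((2 * c * A₁ * (2 : ℝ) ^ ((5 : ℝ) * ((kLo + n : ℤ) : ℝ) / 2) * q_top) ^ (2 ^ (k - (kLo + n) + 1).toNat) /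
        (2 * c * A₁ * (2 : ℝ) ^ ((5 : ℝ) * ((k : ℝ) + 1) / 2))) / (2 * c),
    fun k => if k < kLo then (Q_b * G ^ (kLo - k).toNat) ^ 2 / 2 else if k < kLo + n then
      E_w + q_top ^ 2 / 2 else
      ((2 * c * A₁ * (2 : ℝ) ^ ((5 : ℝ) * ((kLo + n : ℤ) : ℝ) / 2) * q_top) ^ (2 ^ (k - (kLo + n) + 1).toNat) /
        (2 * c * A₁ * (2 : ℝ) ^ ((5 : ℝ) * ((k : ℝ) + 1) / 2))) ^ 2 / 2,
    fun k => c * (2 : ℝ) ^ (-(k : ℝ)) *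
      (Q_b ^ 2 / 2 * (2 : ℝ) ^ ((3 : ℝ) * (kLo : ℝ)) * (8 / (8 - G ^ 2)) +
        n * (2 : ℝ) ^ ((3 : ℝ) * (((kLo + n : ℤ) : ℝ) - 1)) * (E_w + q_top ^ 2 / 2) +
        4 / 3 * (2 : ℝ) ^ (-(2 : ℝ) * ((kLo + n : ℤ) : ℝ)) / (2 * c * A₁) ^ 2), ?_⟩
  refine kit_of_profile (K := kLo + n) (κ := 2 * c * A₁)
    (z₀ := 2 * c * A₁ * (2 : ℝ) ^ ((5 : ℝ) * ((kLo + n : ℤ) : ℝ) / 2) * q_top)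
    hθ hc hkLo hkn rfl hA₀ hAₓ hA₁i hA₁ hA₁s hΦw hEw hE₀ hΦ₀ hqt hΦtop rfl rfl hz hQb hG hG8 hlam hlamG
    hgoal0 hT1 hT2 rfl ?_ ?_ ?_ ?_ ?_ ?_ ?_ ?_ ?_ ?_ ?_ ?_ ?_
  -- the zone equations of the explicit profile
  · intro k hk; rw [if_pos hk]
  · intro k hk1 hk2; rw [if_neg (by omega), if_pos (by omega)]
  · intro k hk; rw [if_neg (by omega), if_neg (by omega)]
  · intro k hk; rw [if_pos hk, if_pos hk]
  · intro k hk1 hk2; rw [if_neg (by omega), if_pos hk2]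
  · intro k hk; rw [if_neg (by omega), if_neg (by omega), if_neg (by omega), if_neg (by omega)]
  · intro k hk; rw [if_pos hk, if_pos hk]
  · intro k hk1 hk2; rw [if_neg (by omega), if_pos hk2]
  · intro k hk; rw [if_neg (by omega), if_neg (by omega), if_neg (by omega), if_neg (by omega)]
  · intro k hk; rw [if_pos hk, if_pos hk]
  · intro k hk1 hk2; rw [if_neg (by omega), if_pos (by omega)]
  · intro k hk; rw [if_neg (by omega), if_neg (by omega), if_neg (by omega), if_neg (by omega)]
  · intro k; rfl

end CertificateProfile

end Summit.NavierStokesRegularity.NavierStokesRegularity.Theorems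

end
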